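import Summits.NavierStokesRegularity.NavierStokesRegularity.Theses.VortexLineClock
import HarnessLib.Audit

/-!
# Birth skeleton (BC3) of the crux `VortexLineClock.TypeIIWindowCore`

(crux item `stmt-NavierStokesRegularity-11272`, rank 2, route
`route-NavierStokesRegularity-VortexLineClock`; tree path `Cruxes/TypeIIWindowCore/Lines/birth.lean`;
registrar `planner-skel-stmt-NavierStokesRegularity-11272-0`, 2026-08-17. The route (rev 0, 2026-08-15)
predates the Lean birth certificate; this file supplies BC3 retroactively. No `Disproof.lean`, no dead
lines and no crux ideas exist for this crux yet; negatives index read 2026-08-17: 4 refuted statements on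
the summit, none about Type-II zooms or self-similar Euler profiles.)

THE CRUX (card K1, INVISCID CORE EXTRACTION in exact-profile form). For `ν, T > 0` and a maximal
classical solution `(u,p)` on `[0,T)` that is Leray–Hopf from a rapidly decaying datum and NOT Type I,
there are `γ, U, Ω` with the WINDOW-PROFILE clauses (`2/5 ≤ γ < 1/2`; `U ∈ C²`, `Ω ∈ C¹`; `div U = 0`;
`mΩ = curl U`, `m > 0`; `U, Ω` globally Lipschitz; `∃ c P`, the stationary self-similar Euler system
`(1−γ)U + DU(γ(y−c)+U) + ∇P = 0`, `DΩ(γ(y−c)+U) − DU Ω = −Ω`; CIV matched decay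
`|Ω| ≤ C⟨y⟩^{−1/γ}`, `|U| ≤ C⟨y⟩^{1−1/γ}`; `‖Ω 0‖ = 1`) AND an Euler-scaling zoom `t_k ↑ T`, centres
`x_k`, amplitudes `A_k = |curl u(t_k)(x_k)| → ∞`, half-max core radii `ℓ_k → 0`, isometries `Q_k`,
local Reynolds numbers `A_k ℓ_k²/ν → ∞`, along which the rescaled vorticity
`y ↦ A_k⁻¹ Q_k⁻¹ curl u(t_k)(x_k + ℓ_k Q_k y)` converges to `Ω` in `C¹` on every ball.

THE CUT — the route's own NOT-DECOMPOSED list for K1 ("choice of zoom, C^{1,α} bounds on rescaled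
vorticity at diverging local Reynolds number, passage of the NS zoom to the stationary self-similar Euler
system, the finite-energy bound 2/5 ≤ γ à la CIV Thm 2.1, global Lipschitz/decay of the limit") cut at
its two natural seams, COMPACTNESS | RIGIDITY | MATCHING:

* `stub_maxVorticityZoom` [L; NS-side compactness + inviscid core — contains the rank-4 crux
  `InviscidVorticityCore` in sequence form AT VORTICITY MAXIMA]: a non-Type-I maximal solution admits a
  zoom whose centres `x_k` are GLOBAL maximum points of `|curl u(t_k)|` (`A_k = ‖curl u(t_k)‖_∞`), with
  half-max cores `ℓ_k → 0`, `A_k → ∞`, `A_k ℓ_k²/ν → ∞`, and a `C¹` limit `Ω`, `‖Ω 0‖ = 1`, of the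
  rescaled vorticity in `C¹` on balls. Ingredients a prover would use: BKM continuation (`‖ω(t)‖_∞`
  unbounded on a maximal solution), Constantin's a-priori `L¹` vorticity bound (`ℓ_k³ A_k ≲ ‖ω‖_{L¹}`,
  so `ℓ_k → 0`), parabolic `C^{1,α}` estimates for the vorticity equation in the rescaled frame (the
  rescaled vorticity is bounded by 1 GLOBALLY at time `t_k` because `x_k` is a maximum), Arzelà–Ascoli +
  diagonal subsequence. Why it might fail: at the vorticity maximum the core may stay at Kolmogorov
  thickness (`A_k ℓ_k² ≲ ν`) while `‖u‖_∞` outruns the Type-I rate by accumulation (the failure mode of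
  `InviscidVorticityCore`), or `‖∇ω‖ ≫ A_k/ℓ_k` in the core (no `C¹` compactness). The MAX clause is
  not decoration: without it, zooms centred ever farther out in profile units satisfy every other
  clause and converge to a homogeneous far-field blow-down with `U ≡ 0`, on which the next stub is false.
* `stub_zoomLimitSelfSimilar` [XL; OPEN — the load-bearing bet, ASYMPTOTIC SELF-SIMILARITY]: along ANY
  max-centred zoom of a non-Type-I maximal Leray–Hopf solution whose rescaled vorticity converges in
  `C¹_loc` to `Ω`, the limit is the normalised vorticity of an EXACT stationary self-similar Euler
  profile in the window: `∃ γ ∈ [2/5, 1/2)`, `U ∈ C²`, `div U = 0`, `mΩ = curl U` (`m > 0`), `c`,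
  `P ∈ C¹` with CIV (3.3)/(3.4). (The profile system is covariant under translations `c ↦ c + a`,
  scalings `U ↦ λ⁻¹U(λ·)`, rotations and the amplitude `m`, so the zoom's normalisations are
  consistent with exactness; `γ < 1/2` is what `A_k ℓ_k²/ν → ∞` encodes, `2/5 ≤ γ` is finite energy,
  CIV Thm 2.1.) Nearest print: Seregin arXiv:2304.04045 Prop. 1.2 (Euler-scaled limits of Type-II
  blow-ups are local-energy ANCIENT weak Euler solutions — no profile, no self-similarity); CIV
  arXiv:2602.17570 Prop. 3.1 (IF approximately self-similar THEN `γ ≤ 1/2`). Why it might fail: the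
  ancient Euler limit may be DSS, translating, multiscale or merely bounded-vorticity eternal (Hou-type
  two-scale cores), i.e. not a fixed point of the self-similar group.
* `stub_matchedAsymptotics` [M/L; CIV MATCHING — the clauses the Euler side consumes]: for any such
  zoom/limit and any `(γ, U, c, P)` as produced by the previous stub, `U` and `Ω` are globally Lipschitz
  and obey the matched decay `|Ω(y)| ≤ C(1+|y|)^{−1/γ}`, `|U(y)| ≤ C(1+|y|)^{1−1/γ}` (CIV (3.7): at
  `|x − x₀| ~ 1` the outer flow is regular, so `(T−t)^{−1}|Ω(y)| = O(1)` at `|y| ~ (T−t)^{−γ}`; exactly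
  the flux decay `FluxCapacityRecurrence` needs and the Lipschitz bound `ProfileClockNoCycle`/Yorke need).
  Why it might fail: if the singular set at time `T` is not an isolated point (a curve through the
  centre), matching fails along its tangent directions and the profile need not decay uniformly; global
  Lipschitz control of `DΩ` is not automatic from the local `C¹` convergence.

`TypeIIWindowCore_of : Theses.VortexLineClock.TypeIIWindowCore` — the ONLY theorem of this file
concluding the crux, BY NAME, no `Prop` hypotheses (A12 layer invariant) — is the composition: zoom and
limit from stub 1, window exponent and exact profile from stub 2, Lipschitz/decay from stub 3, reassembled
in the crux's clause order. Its CLOSED twin `TypeIIWindowCore_of_hyps : <sig 1> → <sig 2> → <sig 3> →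
TypeIIWindowCore` (same proof, stub statements as hypotheses, no placeholder anywhere) is the registrar's
evidence file `bc/TypeIIWindowCore_birth_closed.lean` attached to the crux item.

Disproof used: none exists (no `Disproof.lean` for this crux). Refuter crux-attack (2026-08-15, item
evidence `Evidence.lean`): `NoTypeII → TypeIIWindowCore` ex falso — the crux, and with it stubs 2–3 and
the conclusion of stub 1, are consequences of the rank-0 target; this is inherent to every NS-side
statement conditioned on a Type-II blow-up and is why the BC3 probes below are run against the crux and
the summit, not against `NoTypeII`. No stub is an instance of a refuted statement (negatives index, 4
entries, none on zooms/profiles).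
-/

noncomputable section

open Set Filter Topology Function Metric
open Literature.Analysis.FluidPDE

namespace Summit.NavierStokesRegularity.NavierStokesRegularity.Cruxes.TypeIIWindowCore.Birth

set_option linter.unusedVariables false
set_option linter.dupNamespace false

local notation "ℝ³" => EuclideanSpace ℝ (Fin 3)

/-- **stub 1 — `stub_maxVorticityZoom` (L; NS compactness + inviscid core at vorticity maxima).**
A maximal classical solution on `[0,T)`, Leray–Hopf from a rapidly decaying datum, NOT Type I, admits a
zoom `(t_k, x_k, A_k, ℓ_k, Q_k)` with `x_k` a GLOBAL maximum point of `‖curl u(t_k)‖`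
(`‖curl u(t_k) z‖ ≤ A_k` for all `z`), `t_k ∈ [0,T)`, `t_k → T`, `A_k → ∞`, half-max core radii
`ℓ_k → 0`, local Reynolds numbers `A_k ℓ_k² / ν → ∞`, and a `C¹` field `Ω` with `‖Ω 0‖ = 1` to which the
rescaled vorticity `y ↦ A_k⁻¹ Q_k⁻¹ curl u(t_k)(x_k + ℓ_k Q_k y)` converges in `C¹` on every ball.
Sources: Beale–Kato–Majda 1984 (continuation), Constantin 1990 (`L¹` vorticity bound), Seregin
arXiv:2304.04045 (Euler scaling of Type II), CIV arXiv:2602.17570 §3.1. -/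
theorem stub_maxVorticityZoom :
    ∀ (ν T : ℝ), 0 < ν → 0 < T → ∀ (u : ℝ → ℝ³ → ℝ³) (p : ℝ → ℝ³ → ℝ),
      IsMaximalSmoothSolution ν 0 u p T → IsLerayHopfOn T ν 0 (u 0) u →
      HasRapidSpatialDecay (u 0) → ¬ IsTypeIBlowup u T →
      ∃ Ω : ℝ³ → ℝ³, ContDiff ℝ 1 Ω ∧ ‖Ω 0‖ = 1 ∧
        ∃ (t : ℕ → ℝ) (x : ℕ → ℝ³) (A ℓ : ℕ → ℝ) (Q : ℕ → (ℝ³ ≃ₗᵢ[ℝ] ℝ³)),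
          (∀ k z, ‖curl (u (t k)) z‖ ≤ A k) ∧
          ((∀ k, 0 ≤ t k ∧ t k < T) ∧ Tendsto t atTop (𝓝 T) ∧ (∀ k, 0 < A k ∧ 0 < ℓ k) ∧
            Tendsto A atTop atTop ∧ Tendsto ℓ atTop (𝓝 0) ∧
            (∀ k, ‖curl (u (t k)) (x k)‖ = A k) ∧
            (∀ k, (∀ z, dist z (x k) < ℓ k → A k / 2 < ‖curl (u (t k)) z‖) ∧
              ∃ z, dist z (x k) = ℓ k ∧ ‖curl (u (t k)) z‖ ≤ A k / 2) ∧
            Tendsto (fun k => A k * ℓ k ^ 2 / ν) atTop atTop ∧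
            ∀ R ε : ℝ, 0 < R → 0 < ε → ∃ k₀ : ℕ, ∀ k ≥ k₀, ∀ y : ℝ³, ‖y‖ ≤ R →
              ‖(A k)⁻¹ • (Q k).symm (curl (u (t k)) (x k + ℓ k • Q k y)) - Ω y‖ +
                ‖fderiv ℝ (fun y' => (A k)⁻¹ • (Q k).symm (curl (u (t k)) (x k + ℓ k • Q k y'))) y -
                  fderiv ℝ Ω y‖ ≤ ε) := by
  sorry

/-- **stub 2 — `stub_zoomLimitSelfSimilar` (XL; OPEN — asymptotic self-similarity, the load-bearing
bet).** Along ANY zoom of a non-Type-I maximal Leray–Hopf classical solution from rapidly decaying data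
which is centred at global vorticity maxima, has half-max cores `ℓ_k → 0`, `A_k → ∞`, `A_k ℓ_k²/ν → ∞`,
and whose rescaled vorticity converges in `C¹` on balls to a `C¹` field `Ω`, the limit is the normalised
vorticity of an EXACT stationary self-similar Euler profile in the window: `2/5 ≤ γ < 1/2`, `U ∈ C²`,
`div U = 0`, `m Ω = curl U` for some `m > 0`, and for some centre `c` and `C¹` pressure `P`,
`(1−γ)U + DU(γ(y−c)+U) + ∇P = 0` and `DΩ(γ(y−c)+U) − DU Ω = −Ω` (CIV arXiv:2602.17570 (3.3)–(3.4)).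
Nearest print: Seregin arXiv:2304.04045 Prop. 1.2 (ancient weak Euler limit only); CIV Prop. 3.1. -/
theorem stub_zoomLimitSelfSimilar :
    ∀ (ν T : ℝ), 0 < ν → 0 < T → ∀ (u : ℝ → ℝ³ → ℝ³) (p : ℝ → ℝ³ → ℝ),
      IsMaximalSmoothSolution ν 0 u p T → IsLerayHopfOn T ν 0 (u 0) u →
      HasRapidSpatialDecay (u 0) → ¬ IsTypeIBlowup u T →
      ∀ (Ω : ℝ³ → ℝ³) (t : ℕ → ℝ) (x : ℕ → ℝ³) (A ℓ : ℕ → ℝ) (Q : ℕ → (ℝ³ ≃ₗᵢ[ℝ] ℝ³)),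
        ContDiff ℝ 1 Ω → (∀ k z, ‖curl (u (t k)) z‖ ≤ A k) →
        ((∀ k, 0 ≤ t k ∧ t k < T) ∧ Tendsto t atTop (𝓝 T) ∧ (∀ k, 0 < A k ∧ 0 < ℓ k) ∧
            Tendsto A atTop atTop ∧ Tendsto ℓ atTop (𝓝 0) ∧
            (∀ k, ‖curl (u (t k)) (x k)‖ = A k) ∧
            (∀ k, (∀ z, dist z (x k) < ℓ k → A k / 2 < ‖curl (u (t k)) z‖) ∧
              ∃ z, dist z (x k) = ℓ k ∧ ‖curl (u (t k)) z‖ ≤ A k / 2) ∧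
            Tendsto (fun k => A k * ℓ k ^ 2 / ν) atTop atTop ∧
            ∀ R ε : ℝ, 0 < R → 0 < ε → ∃ k₀ : ℕ, ∀ k ≥ k₀, ∀ y : ℝ³, ‖y‖ ≤ R →
              ‖(A k)⁻¹ • (Q k).symm (curl (u (t k)) (x k + ℓ k • Q k y)) - Ω y‖ +
                ‖fderiv ℝ (fun y' => (A k)⁻¹ • (Q k).symm (curl (u (t k)) (x k + ℓ k • Q k y'))) y -
                  fderiv ℝ Ω y‖ ≤ ε) →
        ∃ (γ : ℝ) (U : ℝ³ → ℝ³), (2 / 5 : ℝ) ≤ γ ∧ γ < 1 / 2 ∧ ContDiff ℝ 2 U ∧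
          VectorCalculus.IsDivFree U ∧ (∃ m : ℝ, 0 < m ∧ ∀ y, m • Ω y = curl U y) ∧
          ∃ (c : ℝ³) (P : ℝ³ → ℝ), ContDiff ℝ 1 P ∧
            (∀ y, (1 - γ) • U y + fderiv ℝ U y (γ • (y - c) + U y) + gradient P y = 0) ∧
            (∀ y, fderiv ℝ Ω y (γ • (y - c) + U y) - fderiv ℝ U y (Ω y) = -(Ω y)) := by
  sorry

/-- **stub 3 — `stub_matchedAsymptotics` (M/L; CIV matching — global Lipschitz bounds and matched
decay of a zoom-limit profile).** For any zoom/limit as in stub 2 and any `(γ, U, c, P)` satisfying its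
conclusion (`2/5 ≤ γ < 1/2`, `U ∈ C²`, `div U = 0`, `mΩ = curl U`, `P ∈ C¹`, the two profile equations),
`U` and `Ω` are globally Lipschitz and `‖Ω y‖ ≤ C (1+‖y‖)^{−1/γ}`, `‖U y‖ ≤ C (1+‖y‖)^{1−1/γ}`
(CIV arXiv:2602.17570 (3.7): matching to the regular outer flow; finite energy of the Leray–Hopf solution).
These are exactly the clauses `FluxCapacityRecurrence` (vorticity flux through `S_R` is
`O(R^{2−1/γ}) → 0`) and `ProfileClockNoCycle` (Yorke's bound needs `Lip Ω < ∞`) consume. -/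
theorem stub_matchedAsymptotics :
    ∀ (ν T : ℝ), 0 < ν → 0 < T → ∀ (u : ℝ → ℝ³ → ℝ³) (p : ℝ → ℝ³ → ℝ),
      IsMaximalSmoothSolution ν 0 u p T → IsLerayHopfOn T ν 0 (u 0) u →
      HasRapidSpatialDecay (u 0) → ¬ IsTypeIBlowup u T →
      ∀ (Ω : ℝ³ → ℝ³) (t : ℕ → ℝ) (x : ℕ → ℝ³) (A ℓ : ℕ → ℝ) (Q : ℕ → (ℝ³ ≃ₗᵢ[ℝ] ℝ³)),
        ContDiff ℝ 1 Ω → (∀ k z, ‖curl (u (t k)) z‖ ≤ A k) →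
        ((∀ k, 0 ≤ t k ∧ t k < T) ∧ Tendsto t atTop (𝓝 T) ∧ (∀ k, 0 < A k ∧ 0 < ℓ k) ∧
            Tendsto A atTop atTop ∧ Tendsto ℓ atTop (𝓝 0) ∧
            (∀ k, ‖curl (u (t k)) (x k)‖ = A k) ∧
            (∀ k, (∀ z, dist z (x k) < ℓ k → A k / 2 < ‖curl (u (t k)) z‖) ∧
              ∃ z, dist z (x k) = ℓ k ∧ ‖curl (u (t k)) z‖ ≤ A k / 2) ∧
            Tendsto (fun k => A k * ℓ k ^ 2 / ν) atTop atTop ∧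
            ∀ R ε : ℝ, 0 < R → 0 < ε → ∃ k₀ : ℕ, ∀ k ≥ k₀, ∀ y : ℝ³, ‖y‖ ≤ R →
              ‖(A k)⁻¹ • (Q k).symm (curl (u (t k)) (x k + ℓ k • Q k y)) - Ω y‖ +
                ‖fderiv ℝ (fun y' => (A k)⁻¹ • (Q k).symm (curl (u (t k)) (x k + ℓ k • Q k y'))) y -
                  fderiv ℝ Ω y‖ ≤ ε) →
        ∀ (γ : ℝ) (U : ℝ³ → ℝ³) (c : ℝ³) (P : ℝ³ → ℝ), (2 / 5 : ℝ) ≤ γ → γ < 1 / 2 →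
          ContDiff ℝ 2 U → VectorCalculus.IsDivFree U → (∃ m : ℝ, 0 < m ∧ ∀ y, m • Ω y = curl U y) →
          ContDiff ℝ 1 P →
          (∀ y, (1 - γ) • U y + fderiv ℝ U y (γ • (y - c) + U y) + gradient P y = 0) →
          (∀ y, fderiv ℝ Ω y (γ • (y - c) + U y) - fderiv ℝ U y (Ω y) = -(Ω y)) →
          (∃ L : NNReal, LipschitzWith L U ∧ LipschitzWith L Ω) ∧
            ∃ C : ℝ, ∀ y, ‖Ω y‖ ≤ C * (1 + ‖y‖) ^ (-(1 / γ)) ∧ ‖U y‖ ≤ C * (1 + ‖y‖) ^ (1 - 1 / γ) := by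
  sorry

/-- **Birth composition (the skeleton theorem).** The crux BY NAME from the three registered stubs,
used by name: zoom at vorticity maxima with its `C¹_loc` limit `Ω` (stub 1); window exponent `γ`,
velocity profile `U`, centre `c` and pressure `P` solving the stationary self-similar Euler system with
`mΩ = curl U` (stub 2); global Lipschitz bounds and matched decay (stub 3); reassembled in the crux's
clause order (the MAX clause of the zoom is dropped). -/
theorem TypeIIWindowCore_of : Theses.VortexLineClock.TypeIIWindowCore := by
  have h1 := stub_maxVorticityZoom
  have h2 := stub_zoomLimitSelfSimilar
  have h3 := stub_matchedAsymptotics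
  intro ν T hν hT u p hmax hLH hdec hnI
  -- stub 1: the max-centred inviscid zoom and its C¹ limit Ω
  obtain ⟨Ω, hΩ, hΩ0, t, x, A, ℓ, Q, hM, hZ⟩ := h1 ν T hν hT u p hmax hLH hdec hnI
  -- stub 2: the limit is an exact self-similar Euler profile in the window
  obtain ⟨γ, U, hγl, hγu, hU, hdiv, hcurl, c, P, hP, hE1, hE2⟩ :=
    h2 ν T hν hT u p hmax hLH hdec hnI Ω t x A ℓ Q hΩ hM hZ
  -- stub 3: matched asymptotics (global Lipschitz + CIV decay)
  obtain ⟨hLip, hdecay⟩ :=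
    h3 ν T hν hT u p hmax hLH hdec hnI Ω t x A ℓ Q hΩ hM hZ γ U c P hγl hγu hU hdiv hcurl hP hE1 hE2
  exact ⟨γ, U, Ω, ⟨hγl, hγu, hU, hΩ, hdiv, hcurl, hLip, ⟨c, P, hP, hE1, hE2⟩, hdecay, hΩ0⟩,
    t, x, A, ℓ, Q, hZ⟩

end Summit.NavierStokesRegularity.NavierStokesRegularity.Cruxes.TypeIIWindowCore.Birth
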